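import Summits.QuantumFields.BalabanUV.T4Continuum.Support.NE3FramePotGauge
import Summits.QuantumFields.BalabanUV.T4Continuum.Support.NE3BlockPoincareCore
import Summits.QuantumFields.BalabanUV.T4Continuum.Support.NE3CoercivityScaling
import HarnessLib

/-!
# NE3FrameFreeSlice (T⁴ programme, node NE3, row NE3-R2; Φ1 of the owner's ruling ρ-g21-3, file 2∕2) — THE FRAME-FREE
# REPRESENTATIVE OBEYS THE N-FREE BLOCK POINCARÉ INEQUALITY, and THE FLAT FRAME-FREE BLOCK-LANDAU SLICE `frameFreeBlockLandau L N k`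

HONEST FRAMING (cell `pub-balaban`, T4-DAG PAGE 1; unit `b2b-balaban-t4-ne3r2-p1` = owner of BINDER-OWNERS row NE3-R2, gen 6; FINDING
F-ne3r2-g6-1 ACCEPTED by the NE3 owner's ruling ρ-g21-3: the curved core of (w4)-P moves to the frame-free slice T_♮(W)).  The cell's T4
target is the finite-torus continuum limit of the unit-scale averaged loop expectations — NOT infinite volume, NO mass gap, NOT Clay, NOT
summit progress.  File 1 `NE3FramePotGauge` proved that every flat k-fold tangent direction is corner-trivially gauge-equivalent to a
FRAME-FREE one (`framePot = 0`, hence `(Qcoarse L)^[k] = 0`).  THIS FILE (all [folklore], 0 sorry):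
§5 END **`blockPoincare_frameFree`** (complex values): for `L, N ≥ 1`, `(L^k)^d ≥ 2`, an `(L^k·N)`-periodic `Y` with `(Tcoarse L)^[k] Y = 0`,
   the frame-free representative `Y′ = Y + dPot (frameKill L k Y)` obeys `Σ‖Y′‖² ≤ 5·(L^k)²·Σ‖∂Y′‖²` over `periodBox (L^k·N)` — leaf-04's
   N-FREE `NE3BlockPoincareCore.sum_norm_sq_le_of_iterate_Qcoarse_eq_zero` applied to `Y′`: the flat (P_1)-type inequality holds on the
   k-fold tangent space MODULO CORNER-TRIVIAL GAUGE with constant 5, no torus factor, no Landau condition, no frame pairing;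
§6 the flat slice **`frameFreeBlockLandau L N k`** (Set of matrix directions: skew, `(N·L^k)`-periodic, `TangentIter L (k−1) flatCfg`,
   `framePot L k = 0`, blockwise-constant `flatDiv` off the block corners — the flat `T_♮(1)` of ρ-g21-3; compare row NE3-R2 gen 5's
   `NE3CoercivityScaling.flatTangentLandau`) with `iterate_Tcoarse_eq_zero_of_mem` and **`iterate_Qcoarse_eq_zero_of_mem`** (on the
   slice the straight k-fold average vanishes, so the N-free core applies entrywise).
Nothing about Bałaban's minimisers, (P_W) at `W ≠ 1`, (ML_w), T-E_w or NE3 is asserted; NE3 NOT proved; spine 0∕9; rung (B)+1.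
ABSOLUTE RULE kept: no printed sentence is a hypothesis (context: [Balaban1985Averaging] (47)–(48) p. 25, (120)–(125) pp. 35–36;
[Balaban1984PropagatorsI] (1.20)–(1.21) p. 20).  PLACEMENT: `Summits/QuantumFields/BalabanUV/`; imports file 1, the crew's
`NE3BlockPoincareCore` and row NE3-R2's `NE3CoercivityScaling` (`flatDiv`) BY NAME; moves nothing.
-/

set_option autoImplicit false

open scoped BigOperators Matrix.Norms.L2Operator
open Finset

namespace Summit.QuantumFields.BalabanUV.T4Continuum.NE3FrameFreeSlice

open Literature.MathematicalPhysics.QuantumFieldTheory.Balaban1983to89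
open B7Prop1Explicit B7Prop3Flat
open T4AveragingDeficitWallBoundary (periodBox mem_periodBox)
open SmoothRefineNeutral (Tcoarse)
open NE3TangentNoGoWords (dPot)
open NE3TangentFlatStructure (Qcoarse framePot iterate_Tcoarse_eq_zero_iff dPot_add_period)
open NE3BlockPoincareCore (sum_norm_sq_le_of_iterate_Qcoarse_eq_zero)
open NE3FramePotGauge

noncomputable section

/-! ## §5 END: the frame-free representative obeys the N-FREE block Poincaré inequality -/

section End

variable {d : ℕ}

/-- **N-FREE BLOCK POINCARÉ ON THE FLAT k-FOLD TANGENT SPACE, MODULO CORNER-TRIVIAL GAUGE** (complex values): for `L, N ≥ 1`,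
`(L^k)^d ≥ 2`, an `(L^k·N)`-periodic `Y` with `(Tcoarse L)^[k] Y = 0`, its frame-free representative `Y′ = Y + dPot (frameKill L k Y)`
(same tangent class, `(L^k·N)`-periodic, corner-trivial gauge) satisfies `Σ_x Σ_κ ‖Y′ x κ‖² ≤ 5·(L^k)²·Σ_x Σ_κ Σ_μ ‖Y′(x+e_μ) κ − Y′ x κ‖²`
over `periodBox (L^k·N)` — leaf-04's `sum_norm_sq_le_of_iterate_Qcoarse_eq_zero` (constant 5, NO torus factor `N²`) applied to `Y′`. [folklore] -/
theorem blockPoincare_frameFree {L : ℕ} (hL : 1 ≤ L) {N : ℕ} (hN : 1 ≤ N) {k : ℕ} (hMd : 2 ≤ (L ^ k) ^ d)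
    (Y : Site d → Fin d → ℂ) (hY : ∀ (x : Site d) (τ μ : Fin d), Y (x + ((L ^ k * N : ℕ) : ℤ) • e τ) μ = Y x μ)
    (hT : (Tcoarse L)^[k] Y = 0) :
    ∑ x ∈ periodBox (d := d) (L ^ k * N), ∑ κ : Fin d, ‖Y x κ + dPot (frameKill L k Y) x κ‖ ^ 2
      ≤ 5 * ((L : ℝ) ^ k) ^ 2 * ∑ x ∈ periodBox (d := d) (L ^ k * N), ∑ κ : Fin d, ∑ μ : Fin d,
          ‖(Y (x + e μ) κ + dPot (frameKill L k Y) (x + e μ) κ) - (Y x κ + dPot (frameKill L k Y) x κ)‖ ^ 2 := by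
  have hY' : ∀ (y : Site d) (τ μ : Fin d), Y (y + ((L : ℤ) ^ k * (N : ℤ)) • e τ) μ = Y y μ := by
    intro y τ μ
    have := hY y τ μ
    push_cast at this
    exact this
  have hξP : ∀ (x : Site d) (τ : Fin d),
      frameKill L k Y (x + ((L ^ k * N : ℕ) : ℤ) • e τ) = frameKill L k Y x := by
    intro x τ
    have := frameKill_add_period hL k hY' x τ
    push_cast at this ⊢
    exact this
  have hP : ∀ (x : Site d) (τ μ : Fin d),
      (fun y μ => Y y μ + dPot (frameKill L k Y) y μ) (x + ((L ^ k * N : ℕ) : ℤ) • e τ) μ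
        = (fun y μ => Y y μ + dPot (frameKill L k Y) y μ) x μ := by
    intro x τ μ
    simp only [hY x τ μ, dPot_add_period hξP x τ μ]
  exact sum_norm_sq_le_of_iterate_Qcoarse_eq_zero hL hN k _ hP (iterate_Qcoarse_add_frameKill hL hMd Y hT)

end End

/-! ## §6 The flat frame-free block-Landau slice (matrices; the owner's `T_♮(1)` of ruling ρ-g21-3) -/

section Slice

variable {d : ℕ} {n : Type*} [Fintype n] [DecidableEq n]

open T4AveragingDeficitWall (IsSkewDir)
open AveragingDeficitPeriodicCounting (IsPeriodicDir)
open AveragingDeficitMultiLevelPrep (TangentIter)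
open MinimalActionWitness (flatCfg)
open NE3CoercivityScaling (flatDiv)
open NE3TangentFlatStructure (iterate_Tcoarse_eq_zero_of_tangentIter)

/-- **THE FLAT FRAME-FREE BLOCK-LANDAU SLICE** at `k` levels on the torus of side `N·L^k` (the flat `T_♮(1)` of ruling ρ-g21-3,
FINDING F-ne3r2-g6-1 §4): skew, `(N·L^k)`-periodic directions, TANGENT to the `k`-fold flat average, FRAME-FREE
(`framePot L k X = 0`), with BLOCKWISE-CONSTANT backward divergence off the block corners (`flatDiv X (L^k•z + v) = c_z` for
`v ∈ [0,L^k)^d`, `v ≠ 0`).  Compare row NE3-R2 gen 5's `NE3CoercivityScaling.flatTangentLandau` (full Landau, no frame condition). [folklore] -/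
def frameFreeBlockLandau (L N k : ℕ) : Set (Site d → Fin d → Matrix n n ℂ) :=
  {X | IsSkewDir X ∧ IsPeriodicDir X ((N * L ^ k : ℕ) : ℤ) ∧ TangentIter L (k - 1) flatCfg X ∧ (∀ z : Site d, framePot L k X z = 0)
      ∧ ∀ z : Site d, ∃ c : Matrix n n ℂ, ∀ v ∈ periodBox (d := d) (L ^ k), v ≠ 0 → flatDiv X (((L ^ k : ℕ) : ℤ) • z + v) = c}

/-- Members of the slice are in `ker (Tcoarse L)^[k]` (`k ≥ 1`; `NE3TangentFlatStructure.iterate_Tcoarse_eq_zero_of_tangentIter`). [folklore] -/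
theorem iterate_Tcoarse_eq_zero_of_mem {L N k : ℕ} (hL : 1 ≤ L) (hk : 1 ≤ k) {X : Site d → Fin d → Matrix n n ℂ}
    (hX : X ∈ frameFreeBlockLandau (d := d) (n := n) L N k) : (Tcoarse L)^[k] X = 0 := by
  obtain ⟨-, -, hT, -, -⟩ := hX
  have h := iterate_Tcoarse_eq_zero_of_tangentIter hL (k - 1) X hT
  rwa [Nat.sub_add_cancel hk] at h

/-- **ON THE SLICE THE STRAIGHT k-FOLD AVERAGE VANISHES**: `X ∈ frameFreeBlockLandau L N k → (Qcoarse L)^[k] X = 0` (`L, k ≥ 1`) —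
so leaf-04's N-FREE core `sum_norm_sq_le_of_iterate_Qcoarse_eq_zero` applies entrywise. [folklore] -/
theorem iterate_Qcoarse_eq_zero_of_mem {L N k : ℕ} (hL : 1 ≤ L) (hk : 1 ≤ k) {X : Site d → Fin d → Matrix n n ℂ}
    (hX : X ∈ frameFreeBlockLandau (d := d) (n := n) L N k) : (Qcoarse L)^[k] X = 0 :=
  iterate_Qcoarse_eq_zero_of_tangent_of_framePot hL X (iterate_Tcoarse_eq_zero_of_mem hL hk hX) hX.2.2.2.1

end Slice

end

end Summit.QuantumFields.BalabanUV.T4Continuum.NE3FrameFreeSlice
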